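import Summits.NavierStokesRegularity.FunctionalMining.NoGo.TopEigHeatLaminateDirichlet
import Summits.NavierStokesRegularity.FunctionalMining.NoGo.TopEigLaminateHeatLine
import Summits.NavierStokesRegularity.FunctionalMining.NoGo.TopEigHeatCoerciveOne
import Mathlib.MeasureTheory.Integral.IntervalIntegral.Periodic
import HarnessLib

/-!
# NO-GO K37b — the `x₂`-laminate class is heat-coercive for EVERY real `q > 1`, at the explicit rate
# `4π²(q−1)/q`: no laminate refutes L-λ(q), `1 < q < 2` included, and no singular weight `|F′|^{q−2}` is formed

search for candidate a priori estimates; no regularity claim.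

Cell `pub-nsfunc` (NS FUNCTIONAL MINING), NOGO seat (gen 47); a structural obstruction on the WITNESS CLASS of
the heat-coercivity lemma L-λ(q) (`TopEigHeatCoercive`, `@[conjecture] TopEig.TopEigHeatCoercivePos q`:
`∃ c > 0, c·∫(λ₁⁺)^q(v) ≤ heatDissipation (∫(λ₁⁺)^q) v` on smooth divergence-free zero-mean `v : T³ → ℝ³`;
static heat line `v + tΔv`, no transport, no pressure). Nothing about Navier–Stokes is proved or asserted here.
The recorded kill at `q = 1` (K32, `NoGo/TopEigHeatCoerciveOne`) is an `x₂`-LAMINATE `u_F = (F(x₂), 0, 0)`; at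
`q = 2` laminates are rigid (`TopEigLaminateTwo.laminate_rigid_two`, rate `8π²`). THIS FILE closes the laminate
door on the whole open half-line `q > 1`, with one explicit rate and both one-sided cores
`Φ_q ∈ {∫(λ₁⁺)^q, ∫((−λ₃)⁺)^q}`:
* `laminate_coercive_gt_one` (`1 < q`): **`(4π²(q−1)/q)·Φ_q(u_F) ≤ heatDissipation Φ_q u_F`** for every smooth
  `1`-periodic profile `F`; `heatCoerciveOn_laminate_gt_one`: `HeatCoerciveOn IsX2Laminate Φ_q (4π²(q−1)/q)`;
  `heatCoercivePos_laminate_gt_one`: **L-λ(q) restricted to the laminate class HOLDS for every real `q > 1`**;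
  `kill_not_laminate_gt_one`: a field with `heatDissipation Φ_q v < c·Φ_q v`, `c ≤ 4π²(q−1)/q`, is NOT an
  `x₂`-laminate — a refutation of `TopEigHeatCoercivePos q` for ANY real `q > 1` needs a non-laminate family.
  The rate tends to `0` as `q → 1⁺`, consistently with K32 (`C_λ(1) = 0`), and stays below the Poincaré ceiling
  `4π²q` of the single Fourier shells (`TopEigHeatRate`); it is not claimed sharp.

Method (the point is `1 < q < 2`, where the dissipation weight `|F′|^{q−2}` of the pen computation is singular and
no integration by parts at `ε = 0` is available). With `G = F′`, `P_t = F′ + tF‴` and the REGULARISED pairing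
`regPairing F q η t = ∫₀¹ q·((P_t² + η²)^{(q−2)/2}P_t)·F‴` (continuous in `η` and in `t` for `q > 1`, K11a
`TopEig.continuous_rpow_normSq_add_sq_smul`): (1) convexity of the heat line (`TopEig.heatDissipation_topEigMoment_eq`,
K33a `topEigMoment_line_half`: `Φ_q(u_F + tΔu_F) = 2^{−q}∫₀¹|P_t|^q`) and the signed tangent inequality at both
base points identify `heatDissipation Φ_q u_F = −2^{−q}·regPairing F q 0 0` for every `q > 1` (a squeeze; no
differentiation under the integral); (2) for `η > 0` everything is smooth: one integration by parts over the
period, `regPairing F q η 0 = −q∫₀¹ φ_η′(G)G′²`, `φ_η(x) = (x²+η²)^{(q−2)/2}x`; the comparison function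
`H_η = (G²+η²)^{(q−2)/4}G` vanishes at a critical point `s₀` of `F` and satisfies POINTWISE
`H_η′² ≤ (q²/(4(q−1)))·φ_η′(G)G′²` (K37a `reg_deriv_sq_le`; the slack is `(q−2)²(qG²η² + η⁴) ≥ 0`); the
Dirichlet–Poincaré inequality with the SHARP constant `π²` on `[s₀, s₀+1]` (K37a `pi_sq_mul_integral_sq_le`:
Picone's identity with the positive supersolution `sin(π(x−s₀+δ)/(1+2δ))`, `δ → 0⁺`) gives
`(4π²(q−1)/q)·∫₀¹(G²+η²)^{(q−2)/2}G² ≤ −regPairing F q η 0`;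
(3) `η → 0⁺` by continuity of two parametric integrals (`TopEig.const_le_of_forall_pos_le`, K11d). Kernel-checked.
RELATION TO THE REST OF DOOR (c). K35 (staged, `NoGo/TopEigHeatLaminateCoercive`, `q ≥ 2`, rate `16(q−1)/q < 4π²(q−1)/q`)
keeps the laminate dissipation IDENTITY for `q > 2`; the present file is independent of it and needs no identity.
On paper a laminate has strain spectrum `{|F′|/2, 0, −|F′|/2}` (relative top gap `1`), so at `q ≥ 2` SOME rate for
the top core should also follow from the gap-class node `TopEig.topEigGapCoercivePos_of_ge_two` once the membership
`StrainGapClass 1 (lamU F)` is typed; below `q = 2` nothing of the kind is in the tree — here the rate is explicit,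
gap-free, both cores, every real `q > 1`.
L-λ(q) itself (`TopEigHeatCoercivePos q`) stays OPEN in the kernel for every real `q > 1`.
[ours] search for candidate a priori estimates; no regularity claim.
FILING (prove seat g28, REQUEST #56): declarations byte-identical to the no-go seat's staged `TopEigHeatLaminateWirtinger.STAGING.lean` af468d1e4e473989; this line is the only addition.
-/

noncomputable section

open MeasureTheory Set intervalIntegral Real Filter
open scoped Topology

namespace Summit.NavierStokesRegularity.FunctionalMining

open Literature.Analysis Literature.Analysis.FunctionSpaces Literature.Analysis.FunctionSpaces.Torus
open TopEig LaminateDirection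
open Literature.Analysis.FluidPDE.LeiZhang2011 (abs_rpow_mul_sq)

namespace TopEigLaminate

/-! ## 1. The signed tangent inequality in regularised form -/

/-- **Signed tangent inequality** for `x ↦ |x|^q`, real `q ≥ 1`, the gradient written as the `η = 0` member
`(a²)^{(q−2)/2}a = |a|^{q−2}a` of the regularised family: `|a|^q + q·((a²)^{(q−2)/2}a)·(p − a) ≤ |p|^q` for all
real `a`, `p` (K33a `tangent_le_abs_rpow` and the symmetry `a ↦ −a`). [folklore] -/
theorem tangent_sqPow_le_abs_rpow {a p q : ℝ} (hq : 1 ≤ q) :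
    |a| ^ q + q * ((a ^ 2) ^ ((q - 2) / 2) * a) * (p - a) ≤ |p| ^ q := by
  rw [sq_rpow_eq_abs_rpow, show 2 * ((q - 2) / 2) = q - 2 by ring]
  rcases lt_trichotomy a 0 with ha | rfl | ha
  · have h := tangent_le_abs_rpow (a := -a) (P := -p) (by linarith) hq
    have e2 : (-a) ^ (q - 2) * a = -(-a) ^ (q - 1) := by
      rw [show q - 1 = (q - 2) + 1 by ring, rpow_add (by linarith : (0 : ℝ) < -a), rpow_one]; ring
    rw [abs_of_neg ha, e2, ← abs_neg p]
    calc (-a) ^ q + q * -(-a) ^ (q - 1) * (p - a) = (-a) ^ q + q * (-a) ^ (q - 1) * (-p - -a) := by ring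
      _ ≤ |(-p)| ^ q := h
  · simp only [abs_zero, mul_zero, zero_mul, add_zero]
    rw [zero_rpow (by linarith)]; exact rpow_nonneg (abs_nonneg p) q
  · have h := tangent_le_abs_rpow (a := a) (P := p) ha.le hq
    have e2 : a ^ (q - 2) * a = a ^ (q - 1) := by rw [show q - 1 = (q - 2) + 1 by ring, rpow_add ha, rpow_one]
    rw [abs_of_pos ha, e2]; exact h

/-! ## 2. The heat line of a laminate for every real `q > 1`: the regularised pairing and the dissipation -/

variable (F : ShearProfile)

/-- **The regularised pairing** `regPairing F q η t = ∫₀¹ q·((P_t² + η²)^{(q−2)/2}·P_t)·F‴`, `P_t = F′ + tF‴`: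
at `η = 0` the formal `t`-derivative of `∫₀¹|F′ + tF‴|^q`; for `η ≠ 0` a smooth integrand. [ours; bookkeeping] -/
def regPairing (q η t : ℝ) : ℝ :=
  ∫ s in (0 : ℝ)..1, q * (((F.D s + t * F.D.D.D s) ^ 2 + η ^ 2) ^ ((q - 2) / 2) * (F.D s + t * F.D.D.D s)) * F.D.D.D s

/-- The integrand of `regPairing` is jointly continuous in `((η, t), s)` for `q > 1`. [ours; bookkeeping] -/
theorem continuous_regLineIntegrand {q : ℝ} (hq : 1 < q) :
    Continuous fun p : (ℝ × ℝ) × ℝ =>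
      q * (((F.D p.2 + p.1.2 * F.D.D.D p.2) ^ 2 + p.1.1 ^ 2) ^ ((q - 2) / 2) * (F.D p.2 + p.1.2 * F.D.D.D p.2)) *
        F.D.D.D p.2 := by
  have h1 := F.D.continuous
  have h3 := F.D.D.D.continuous
  have hP : Continuous fun p : (ℝ × ℝ) × ℝ => F.D p.2 + p.1.2 * F.D.D.D p.2 := by fun_prop
  have hη : Continuous fun p : (ℝ × ℝ) × ℝ => p.1.1 := by fun_prop
  exact (continuous_const.mul ((continuous_sqReg_mul (b := (q - 2) / 2) (by linarith)).comp (hη.prodMk hP))).mul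
    (h3.comp continuous_snd)

/-- **`t ↦ regPairing F q η t` is continuous** for `q > 1` (any fixed `η`; parametric interval integral). [ours] -/
theorem continuous_regPairing_right {q : ℝ} (hq : 1 < q) (η : ℝ) : Continuous fun t : ℝ => regPairing F q η t := by
  have hf : Continuous fun p : ℝ × ℝ =>
      q * (((F.D p.2 + p.1 * F.D.D.D p.2) ^ 2 + η ^ 2) ^ ((q - 2) / 2) * (F.D p.2 + p.1 * F.D.D.D p.2)) * F.D.D.D p.2 :=
    (continuous_regLineIntegrand F hq).comp' (f := fun p : ℝ × ℝ => ((η, p.1), p.2)) (by fun_prop)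
  exact intervalIntegral.continuous_parametric_intervalIntegral_of_continuous'
    (f := fun t s => q * (((F.D s + t * F.D.D.D s) ^ 2 + η ^ 2) ^ ((q - 2) / 2) * (F.D s + t * F.D.D.D s)) * F.D.D.D s)
    hf 0 1

/-- **`η ↦ regPairing F q η t` is continuous** for `q > 1` (any fixed `t`). [ours] -/
theorem continuous_regPairing_left {q : ℝ} (hq : 1 < q) (t : ℝ) : Continuous fun η : ℝ => regPairing F q η t := by
  have hf : Continuous fun p : ℝ × ℝ =>
      q * (((F.D p.2 + t * F.D.D.D p.2) ^ 2 + p.1 ^ 2) ^ ((q - 2) / 2) * (F.D p.2 + t * F.D.D.D p.2)) * F.D.D.D p.2 :=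
    (continuous_regLineIntegrand F hq).comp' (f := fun p : ℝ × ℝ => ((p.1, t), p.2)) (by fun_prop)
  exact intervalIntegral.continuous_parametric_intervalIntegral_of_continuous'
    (f := fun η s => q * (((F.D s + t * F.D.D.D s) ^ 2 + η ^ 2) ^ ((q - 2) / 2) * (F.D s + t * F.D.D.D s)) * F.D.D.D s)
    hf 0 1

/-- Continuity of the `η = 0` integrand `s ↦ q·((P_t²)^{(q−2)/2}P_t)·F‴` (`q > 1`). [ours; bookkeeping] -/
theorem continuous_sqPowLine {q : ℝ} (hq : 1 < q) (t : ℝ) :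
    Continuous fun s : ℝ => q * (((F.D s + t * F.D.D.D s) ^ 2) ^ ((q - 2) / 2) * (F.D s + t * F.D.D.D s)) * F.D.D.D s := by
  have hP : Continuous fun s : ℝ => F.D s + t * F.D.D.D s := F.D.continuous.add (continuous_const.mul F.D.D.D.continuous)
  exact (continuous_const.mul ((continuous_sqPow_mul (b := (q - 2) / 2) (by linarith)).comp hP)).mul F.D.D.D.continuous

/-- `regPairing F q 0 t` without the vanishing regularisation term. [ours; bookkeeping] -/
theorem regPairing_zero_left (q t : ℝ) : regPairing F q 0 t =
    ∫ s in (0 : ℝ)..1, q * (((F.D s + t * F.D.D.D s) ^ 2) ^ ((q - 2) / 2) * (F.D s + t * F.D.D.D s)) * F.D.D.D s := by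
  simp only [regPairing, ne_eq, OfNat.ofNat_ne_zero, not_false_eq_true, zero_pow, add_zero]

/-- **Two-sided tangent bounds along the line** (`q > 1`): `∫₀¹|F′|^q + t·regPairing F q 0 0 ≤ ∫₀¹|F′ + tF‴|^q ≤
∫₀¹|F′|^q + t·regPairing F q 0 t` for every real `t`. [ours] -/
theorem integral_absLine_rpow_bounds {q : ℝ} (hq : 1 < q) (t : ℝ) :
    (∫ s in (0 : ℝ)..1, |F.D s| ^ q) + t * regPairing F q 0 0 ≤ ∫ s in (0 : ℝ)..1, |F.D s + t * F.D.D.D s| ^ q ∧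
      ∫ s in (0 : ℝ)..1, |F.D s + t * F.D.D.D s| ^ q ≤ (∫ s in (0 : ℝ)..1, |F.D s| ^ q) + t * regPairing F q 0 t := by
  have h0 := continuous_sqPowLine F hq 0
  have ht := continuous_sqPowLine F hq t
  have hct : ∀ τ : ℝ, Continuous fun s : ℝ => |F.D s + τ * F.D.D.D s| ^ q := fun τ =>
    (F.D.continuous.add (continuous_const.mul F.D.D.D.continuous)).abs.rpow_const fun _ => Or.inr (by linarith)
  have hc0 := hct 0
  replace hct := hct t
  simp only [zero_mul, add_zero] at h0 hc0
  rw [regPairing_zero_left, regPairing_zero_left]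
  simp only [zero_mul, add_zero]
  constructor
  · rw [← intervalIntegral.integral_const_mul, ← intervalIntegral.integral_add]
    · refine intervalIntegral.integral_mono zero_le_one
        ((hc0.add (continuous_const.mul h0)).intervalIntegrable _ _) (hct.intervalIntegrable _ _) fun s => ?_
      have h := tangent_sqPow_le_abs_rpow (a := F.D s) (p := F.D s + t * F.D.D.D s) hq.le
      calc |F.D s| ^ q + t * (q * ((F.D s ^ 2) ^ ((q - 2) / 2) * F.D s) * F.D.D.D s)
            = |F.D s| ^ q + q * ((F.D s ^ 2) ^ ((q - 2) / 2) * F.D s) * (F.D s + t * F.D.D.D s - F.D s) := by ring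
        _ ≤ |F.D s + t * F.D.D.D s| ^ q := h
    · exact hc0.intervalIntegrable _ _
    · exact (continuous_const.mul h0).intervalIntegrable _ _
  · rw [← intervalIntegral.integral_const_mul, ← intervalIntegral.integral_add]
    · refine intervalIntegral.integral_mono zero_le_one (hct.intervalIntegrable _ _)
        ((hc0.add (continuous_const.mul ht)).intervalIntegrable _ _) fun s => ?_
      have h := tangent_sqPow_le_abs_rpow (a := F.D s + t * F.D.D.D s) (p := F.D s) hq.le
      calc |F.D s + t * F.D.D.D s| ^ q
            ≤ |F.D s| ^ q - q * (((F.D s + t * F.D.D.D s) ^ 2) ^ ((q - 2) / 2) * (F.D s + t * F.D.D.D s)) *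
                (F.D s - (F.D s + t * F.D.D.D s)) := by linarith
        _ = |F.D s| ^ q + t * (q * (((F.D s + t * F.D.D.D s) ^ 2) ^ ((q - 2) / 2) * (F.D s + t * F.D.D.D s)) *
                F.D.D.D s) := by ring
    · exact hc0.intervalIntegrable _ _
    · exact (continuous_const.mul ht).intervalIntegrable _ _

/-- **Identification of the right derivative** (`q > 1`): if `M(t) = 2^{−q}∫₀¹|F′ + tF‴|^q` has right derivative
`m` at `0`, then `m = 2^{−q}·regPairing F q 0 0` (squeeze between the two tangent bounds, continuity in `t`). [ours] -/
theorem rightDeriv_line_eq_regPairing {q : ℝ} (hq : 1 < q) {M : ℝ → ℝ} {m : ℝ}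
    (hline : ∀ t : ℝ, M t = (1 / 2 : ℝ) ^ q * ∫ s in (0 : ℝ)..1, |F.D s + t * F.D.D.D s| ^ q)
    (hderiv : HasDerivWithinAt M m (Set.Ioi 0) 0) : m = (1 / 2 : ℝ) ^ q * regPairing F q 0 0 := by
  have hc : 0 < (1 / 2 : ℝ) ^ q := rpow_pos_of_pos (by norm_num) q
  have hM0 : M 0 = (1 / 2 : ℝ) ^ q * ∫ s in (0 : ℝ)..1, |F.D s| ^ q := by rw [hline 0]; simp only [zero_mul, add_zero]
  have ht : Tendsto (slope M 0) (𝓝[Set.Ioi 0] 0) (𝓝 m) := (hasDerivWithinAt_iff_tendsto_slope' (by simp)).1 hderiv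
  have hslope : ∀ t : ℝ, 0 < t → slope M 0 t =
      (1 / 2 : ℝ) ^ q * ((∫ s in (0 : ℝ)..1, |F.D s + t * F.D.D.D s| ^ q) - ∫ s in (0 : ℝ)..1, |F.D s| ^ q) / t := by
    intro t _
    rw [slope_def_field, sub_zero, hline t, hM0]; ring
  have hlow : ∀ᶠ t in 𝓝[Set.Ioi 0] 0, (1 / 2 : ℝ) ^ q * regPairing F q 0 0 ≤ slope M 0 t := by
    refine eventually_nhdsWithin_of_forall fun t (htp : 0 < t) => ?_
    rw [hslope t htp, le_div_iff₀ htp]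
    nlinarith [(integral_absLine_rpow_bounds F hq t).1, hc]
  have hup : ∀ᶠ t in 𝓝[Set.Ioi 0] 0, slope M 0 t ≤ (1 / 2 : ℝ) ^ q * regPairing F q 0 t := by
    refine eventually_nhdsWithin_of_forall fun t (htp : 0 < t) => ?_
    rw [hslope t htp, div_le_iff₀ htp]
    nlinarith [(integral_absLine_rpow_bounds F hq t).2, hc]
  have hJ : Continuous fun t : ℝ => regPairing F q 0 t := continuous_regPairing_right F hq 0
  have hU : Tendsto (fun t : ℝ => (1 / 2 : ℝ) ^ q * regPairing F q 0 t) (𝓝[Set.Ioi 0] 0)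
      (𝓝 ((1 / 2 : ℝ) ^ q * regPairing F q 0 0)) := ((hJ.tendsto 0).mono_left nhdsWithin_le_nhds).const_mul _
  exact tendsto_nhds_unique ht (tendsto_of_tendsto_of_tendsto_of_le_of_le' tendsto_const_nhds hU hlow hup)

/-- **The dissipation of a laminate is `−2^{−q}·regPairing F q 0 0`**, both cores, every real `q > 1`. [ours] -/
theorem heatDissipation_lamU_eq_neg_regPairing {q : ℝ} (hq : 1 < q) :
    heatDissipation (torusTopEigMoment q) (lamU F) = -((1 / 2 : ℝ) ^ q * regPairing F q 0 0) ∧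
      heatDissipation (torusNegBotEigMoment q) (lamU F) = -((1 / 2 : ℝ) ^ q * regPairing F q 0 0) := by
  have hq0 : (0 : ℝ) < q := by linarith
  obtain ⟨hd1, he1⟩ := heatDissipation_topEigMoment_eq hq.le (isSmooth_lamU F)
  obtain ⟨hd2, he2⟩ := heatDissipation_negBotEigMoment_eq hq.le (isSmooth_lamU F)
  exact ⟨by rw [he1, rightDeriv_line_eq_regPairing F hq (fun t => (topEigMoment_line_half F t hq0).1) hd1],
    by rw [he2, rightDeriv_line_eq_regPairing F hq (fun t => (topEigMoment_line_half F t hq0).2) hd2]⟩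

/-! ## 3. The regularised Poincaré step (`η > 0`) and the limit `η → 0⁺` -/

/-- **Integration by parts at `η ≠ 0`**: `regPairing F q η 0 = −q·∫₀¹ φ_η′(F′)·(F″)²`,
`φ_η′(x) = (x²+η²)^{(q−2)/2−1}((q−1)x² + η²)` (everything smooth and `1`-periodic; no boundary terms). [ours] -/
theorem regPairing_eq_neg_integral {η : ℝ} (hη : η ≠ 0) (q : ℝ) :
    regPairing F q η 0 = -(q * ∫ s in (0 : ℝ)..1,
      (F.D s ^ 2 + η ^ 2) ^ ((q - 2) / 2 - 1) * ((2 * ((q - 2) / 2) + 1) * F.D s ^ 2 + η ^ 2) * F.D.D s ^ 2) := by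
  have h1 := F.D.continuous
  have h2 := F.D.D.continuous
  have hw : ∀ s : ℝ, 0 < F.D s ^ 2 + η ^ 2 := fun s => add_pos_of_nonneg_of_pos (sq_nonneg _) (by positivity)
  have hu : ∀ x, HasDerivAt (fun s : ℝ => (F.D s ^ 2 + η ^ 2) ^ ((q - 2) / 2) * F.D s)
      ((F.D x ^ 2 + η ^ 2) ^ ((q - 2) / 2 - 1) * ((2 * ((q - 2) / 2) + 1) * F.D x ^ 2 + η ^ 2) * F.D.D x) x :=
    fun x => (hasDerivAt_sqReg_mul ((q - 2) / 2) hη (F.D x)).comp x (hasDerivAt_D F.D x)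
  have hu'c : Continuous fun x : ℝ =>
      (F.D x ^ 2 + η ^ 2) ^ ((q - 2) / 2 - 1) * ((2 * ((q - 2) / 2) + 1) * F.D x ^ 2 + η ^ 2) * F.D.D x :=
    ((((h1.pow 2).add continuous_const).rpow_const fun s => Or.inl (hw s).ne').mul (by fun_prop)).mul h2
  have h := intervalIntegral.integral_mul_deriv_eq_deriv_mul (a := 0) (b := 1)
    (u := fun s : ℝ => (F.D s ^ 2 + η ^ 2) ^ ((q - 2) / 2) * F.D s) (v := (F.D.D : ℝ → ℝ))
    (u' := fun x : ℝ => (F.D x ^ 2 + η ^ 2) ^ ((q - 2) / 2 - 1) * ((2 * ((q - 2) / 2) + 1) * F.D x ^ 2 + η ^ 2) * F.D.D x)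
    (v' := (F.D.D.D : ℝ → ℝ)) (fun x _ => hu x) (fun x _ => hasDerivAt_D F.D.D x) (hu'c.intervalIntegrable _ _)
    (F.D.D.D.continuous.intervalIntegrable _ _)
  have hp1 : F.D 1 = F.D 0 := by have := F.D.periodic 0; simpa using this
  have hp2 : F.D.D 1 = F.D.D 0 := by have := F.D.D.periodic 0; simpa using this
  have e1 : regPairing F q η 0 = q * ∫ s in (0 : ℝ)..1, (F.D s ^ 2 + η ^ 2) ^ ((q - 2) / 2) * F.D s * F.D.D.D s := by
    rw [regPairing, ← intervalIntegral.integral_const_mul]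
    exact intervalIntegral.integral_congr fun s _ => by simp only [zero_mul, add_zero]; ring
  have e2 : ∫ s in (0 : ℝ)..1, (F.D s ^ 2 + η ^ 2) ^ ((q - 2) / 2 - 1) * ((2 * ((q - 2) / 2) + 1) * F.D s ^ 2 + η ^ 2) *
        F.D.D s * F.D.D s = ∫ s in (0 : ℝ)..1,
        (F.D s ^ 2 + η ^ 2) ^ ((q - 2) / 2 - 1) * ((2 * ((q - 2) / 2) + 1) * F.D s ^ 2 + η ^ 2) * F.D.D s ^ 2 :=
    intervalIntegral.integral_congr fun s _ => by ring
  rw [e1, h, hp1, hp2, sub_self, zero_sub, e2]; ring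

/-- **The regularised laminate Poincaré inequality** (`q > 1`, `η > 0`):
`(4π²(q−1)/q)·∫₀¹(F′² + η²)^{(q−2)/2}F′² ≤ −regPairing F q η 0`. The comparison function
`H_η = (F′²+η²)^{(q−2)/4}F′` vanishes at a critical point `s₀` of the periodic `F` and one period later;
`π²∫H_η² ≤ ∫H_η′²` (`pi_sq_mul_integral_sq_le` on `[s₀, s₀+1]`, shifted back to `[0, 1]` by periodicity),
`H_η′² ≤ (q²/(4(q−1)))φ_η′(F′)F″²` pointwise (`reg_deriv_sq_le`), and `∫φ_η′(F′)F″² = −regPairing/q`. [ours] -/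
theorem reg_laminate_coercive {q η : ℝ} (hq : 1 < q) (hη : 0 < η) :
    4 * π ^ 2 * (q - 1) / q * ∫ s in (0 : ℝ)..1, (F.D s ^ 2 + η ^ 2) ^ ((q - 2) / 2) * F.D s ^ 2 ≤
      -regPairing F q η 0 := by
  have h1 := F.D.continuous
  have h2 := F.D.D.continuous
  have hq0 : (0 : ℝ) < q := by linarith
  have hw : ∀ s : ℝ, 0 < F.D s ^ 2 + η ^ 2 := fun s => add_pos_of_nonneg_of_pos (sq_nonneg _) (by positivity)
  -- a critical point of `F`
  obtain ⟨s₀, hs₀⟩ : ∃ s₀ : ℝ, F.D s₀ = 0 := by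
    obtain ⟨s₀, -, hmax⟩ := isCompact_Icc.exists_isMaxOn (Set.nonempty_Icc.2 (zero_le_one' ℝ)) F.continuous.continuousOn
    have hall : ∀ x : ℝ, F x ≤ F s₀ := fun x => by
      have hx : F (x - ⌊x⌋) = F x := by simpa using F.periodic.sub_int_mul_eq (x := x) ⌊x⌋
      rw [← hx, Int.self_sub_floor]
      exact hmax ⟨Int.fract_nonneg x, (Int.fract_lt_one x).le⟩
    have hloc : IsLocalMax (F : ℝ → ℝ) s₀ := Filter.Eventually.of_forall hall
    exact ⟨s₀, by rw [ShearProfile.D_apply]; exact hloc.deriv_eq_zero⟩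
  -- the comparison function `H_η` and its derivative
  have hH : ∀ x, HasDerivAt (fun s : ℝ => (F.D s ^ 2 + η ^ 2) ^ ((q - 2) / 4) * F.D s)
      ((F.D x ^ 2 + η ^ 2) ^ ((q - 2) / 4 - 1) * ((2 * ((q - 2) / 4) + 1) * F.D x ^ 2 + η ^ 2) * F.D.D x) x :=
    fun x => (hasDerivAt_sqReg_mul ((q - 2) / 4) hη.ne' (F.D x)).comp x (hasDerivAt_D F.D x)
  have hH'c : Continuous fun x : ℝ =>
      (F.D x ^ 2 + η ^ 2) ^ ((q - 2) / 4 - 1) * ((2 * ((q - 2) / 4) + 1) * F.D x ^ 2 + η ^ 2) * F.D.D x :=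
    ((((h1.pow 2).add continuous_const).rpow_const fun s => Or.inl (hw s).ne').mul (by fun_prop)).mul h2
  -- Dirichlet–Poincaré on `[s₀, s₀ + 1]`, shifted to `[0, 1]`
  have hDP := pi_sq_mul_integral_sq_le (a := s₀) hH hH'c
    (show (F.D s₀ ^ 2 + η ^ 2) ^ ((q - 2) / 4) * F.D s₀ = 0 by rw [hs₀, mul_zero])
    (show (F.D (s₀ + 1) ^ 2 + η ^ 2) ^ ((q - 2) / 4) * F.D (s₀ + 1) = 0 by rw [F.D.periodic s₀, hs₀, mul_zero])
  have hper1 : Function.Periodic (fun s : ℝ => ((F.D s ^ 2 + η ^ 2) ^ ((q - 2) / 4) * F.D s) ^ 2) 1 := fun s => by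
    simp only [F.D.periodic s]
  have hper2 : Function.Periodic (fun x : ℝ =>
      ((F.D x ^ 2 + η ^ 2) ^ ((q - 2) / 4 - 1) * ((2 * ((q - 2) / 4) + 1) * F.D x ^ 2 + η ^ 2) * F.D.D x) ^ 2) 1 :=
    fun s => by simp only [F.D.periodic s, F.D.D.periodic s]
  rw [hper1.intervalIntegral_add_eq s₀ 0, hper2.intervalIntegral_add_eq s₀ 0, zero_add] at hDP
  -- `∫ H_η² = ∫ (F′²+η²)^{(q−2)/2} F′²`
  have eH : ∫ s in (0 : ℝ)..1, ((F.D s ^ 2 + η ^ 2) ^ ((q - 2) / 4) * F.D s) ^ 2 =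
      ∫ s in (0 : ℝ)..1, (F.D s ^ 2 + η ^ 2) ^ ((q - 2) / 2) * F.D s ^ 2 :=
    intervalIntegral.integral_congr fun s _ => by
      rw [mul_pow, ← rpow_two ((F.D s ^ 2 + η ^ 2) ^ ((q - 2) / 4)), ← rpow_mul (hw s).le,
        show (q - 2) / 4 * 2 = (q - 2) / 2 by ring]
  -- `∫ H_η′² ≤ (q²/(4(q−1))) ∫ φ_η′(F′) F″²`
  have hcmp : ∫ x in (0 : ℝ)..1,
      ((F.D x ^ 2 + η ^ 2) ^ ((q - 2) / 4 - 1) * ((2 * ((q - 2) / 4) + 1) * F.D x ^ 2 + η ^ 2) * F.D.D x) ^ 2 ≤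
      ∫ x in (0 : ℝ)..1, q ^ 2 / (4 * (q - 1)) *
        ((F.D x ^ 2 + η ^ 2) ^ ((q - 2) / 2 - 1) * ((2 * ((q - 2) / 2) + 1) * F.D x ^ 2 + η ^ 2) * F.D.D x ^ 2) := by
    have hφc : Continuous fun x : ℝ =>
        (F.D x ^ 2 + η ^ 2) ^ ((q - 2) / 2 - 1) * ((2 * ((q - 2) / 2) + 1) * F.D x ^ 2 + η ^ 2) * F.D.D x ^ 2 :=
      ((((h1.pow 2).add continuous_const).rpow_const fun s => Or.inl (hw s).ne').mul (by fun_prop)).mul (h2.pow 2)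
    exact intervalIntegral.integral_mono_on zero_le_one ((hH'c.pow 2).intervalIntegrable _ _)
      ((continuous_const.mul hφc).intervalIntegrable _ _) fun x _ => reg_deriv_sq_le hq hη.ne' (F.D x) (F.D.D x)
  rw [intervalIntegral.integral_const_mul] at hcmp
  have hIBP := regPairing_eq_neg_integral F hη.ne' q
  rw [eH] at hDP
  -- bookkeeping: `π²·A ≤ (q²/(4(q−1)))·I₂` and `regPairing = −q·I₂`
  have h4 : 0 < 4 * (q - 1) := by linarith
  have key := hDP.trans hcmp
  rw [div_mul_eq_mul_div, le_div_iff₀ h4] at key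
  rw [hIBP, neg_neg, div_mul_eq_mul_div, div_le_iff₀ hq0]
  nlinarith [key]

/-- **The laminate line inequality for every real `q > 1`**: `(4π²(q−1)/q)·∫₀¹|F′|^q ≤ −regPairing F q 0 0`
(`η → 0⁺` in `reg_laminate_coercive`: both sides are parametric integrals continuous in `η`, and at `η = 0`
`(F′²)^{(q−2)/2}F′² = |F′|^q`). [ours] -/
theorem laminate_line_coercive {q : ℝ} (hq : 1 < q) :
    4 * π ^ 2 * (q - 1) / q * ∫ s in (0 : ℝ)..1, |F.D s| ^ q ≤ -regPairing F q 0 0 := by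
  have h1 := F.D.continuous
  have hA : Continuous fun η : ℝ => ∫ s in (0 : ℝ)..1, (F.D s ^ 2 + η ^ 2) ^ ((q - 2) / 2) * F.D s ^ 2 := by
    have hint : Continuous fun p : ℝ × ℝ => (F.D p.2 ^ 2 + p.1 ^ 2) ^ ((q - 2) / 2) * F.D p.2 * F.D p.2 :=
      ((continuous_sqReg_mul (b := (q - 2) / 2) (by linarith)).comp (continuous_fst.prodMk (h1.comp continuous_snd))).mul
        (h1.comp continuous_snd)
    have h : Continuous fun η : ℝ => ∫ s in (0 : ℝ)..1, (F.D s ^ 2 + η ^ 2) ^ ((q - 2) / 2) * F.D s * F.D s :=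
      intervalIntegral.continuous_parametric_intervalIntegral_of_continuous'
        (f := fun (η s : ℝ) => (F.D s ^ 2 + η ^ 2) ^ ((q - 2) / 2) * F.D s * F.D s) hint 0 1
    exact h.congr fun η => intervalIntegral.integral_congr fun s _ => by ring
  have hB : Continuous fun η : ℝ => regPairing F q η 0 := continuous_regPairing_left F hq 0
  have key := const_le_of_forall_pos_le (A := 0)
    (B := fun η : ℝ => -regPairing F q η 0 -
      4 * π ^ 2 * (q - 1) / q * ∫ s in (0 : ℝ)..1, (F.D s ^ 2 + η ^ 2) ^ ((q - 2) / 2) * F.D s ^ 2)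
    (hB.neg.sub (continuous_const.mul hA)).continuousAt fun η hη _ => sub_nonneg.2 (reg_laminate_coercive F hq hη)
  have e0 : ∫ s in (0 : ℝ)..1, (F.D s ^ 2 + (0 : ℝ) ^ 2) ^ ((q - 2) / 2) * F.D s ^ 2 = ∫ s in (0 : ℝ)..1, |F.D s| ^ q :=
    intervalIntegral.integral_congr fun s _ => by
      simp only [ne_eq, OfNat.ofNat_ne_zero, not_false_eq_true, zero_pow, add_zero]
      exact sq_rpow_mul_sq (F.D s) (by linarith)
  have h0 := sub_nonneg.1 key
  rwa [e0] at h0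

/-! ## 4. Laminate heat-coercivity for every real `q > 1` -/

/-- **LAMINATE COERCIVITY for every real `q > 1`, rate `4π²(q−1)/q`**:
`(4π²(q−1)/q)·∫(λ₁⁺)^q(u_F) ≤ heatDissipation (∫(λ₁⁺)^q) u_F` for every smooth `1`-periodic `F`, and the same
for the `−λ₃` core. [ours] -/
theorem laminate_coercive_gt_one {q : ℝ} (hq : 1 < q) :
    4 * π ^ 2 * (q - 1) / q * torusTopEigMoment q (lamU F) ≤ heatDissipation (torusTopEigMoment q) (lamU F) ∧
      4 * π ^ 2 * (q - 1) / q * torusNegBotEigMoment q (lamU F) ≤ heatDissipation (torusNegBotEigMoment q) (lamU F) := by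
  have hq0 : (0 : ℝ) < q := by linarith
  have hc : 0 < (1 / 2 : ℝ) ^ q := rpow_pos_of_pos (by norm_num) q
  obtain ⟨hΦ1, hΦ2⟩ : torusTopEigMoment q (lamU F) = (1 / 2 : ℝ) ^ q * ∫ s in (0 : ℝ)..1, |F.D s| ^ q ∧
      torusNegBotEigMoment q (lamU F) = (1 / 2 : ℝ) ^ q * ∫ s in (0 : ℝ)..1, |F.D s| ^ q := by
    simpa only [zero_smul, add_zero, zero_mul] using topEigMoment_line_half F 0 hq0
  obtain ⟨hD1, hD2⟩ := heatDissipation_lamU_eq_neg_regPairing F hq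
  have key : 4 * π ^ 2 * (q - 1) / q * ((1 / 2 : ℝ) ^ q * ∫ s in (0 : ℝ)..1, |F.D s| ^ q) ≤
      -((1 / 2 : ℝ) ^ q * regPairing F q 0 0) := by
    have h := mul_le_mul_of_nonneg_left (laminate_line_coercive F hq) hc.le
    calc 4 * π ^ 2 * (q - 1) / q * ((1 / 2 : ℝ) ^ q * ∫ s in (0 : ℝ)..1, |F.D s| ^ q)
          = (1 / 2 : ℝ) ^ q * (4 * π ^ 2 * (q - 1) / q * ∫ s in (0 : ℝ)..1, |F.D s| ^ q) := by ring
      _ ≤ (1 / 2 : ℝ) ^ q * -regPairing F q 0 0 := h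
      _ = -((1 / 2 : ℝ) ^ q * regPairing F q 0 0) := by ring
  exact ⟨by rw [hΦ1, hD1]; exact key, by rw [hΦ2, hD2]; exact key⟩

/-- **THE LAMINATE CLASS IS HEAT-COERCIVE FOR EVERY REAL `q > 1`** (dictionary vocabulary of `TopEigHeatCoerciveGap`):
`HeatCoerciveOn IsX2Laminate (∫(λ₁⁺)^q) (4π²(q−1)/q)`, both cores. [ours] -/
theorem heatCoerciveOn_laminate_gt_one {q : ℝ} (hq : 1 < q) :
    HeatCoerciveOn (d := Fin 3) IsX2Laminate (torusTopEigMoment q) (4 * π ^ 2 * (q - 1) / q) ∧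
      HeatCoerciveOn (d := Fin 3) IsX2Laminate (torusNegBotEigMoment q) (4 * π ^ 2 * (q - 1) / q) :=
  ⟨by rintro - v - - - ⟨F, rfl⟩; exact (laminate_coercive_gt_one F hq).1,
    by rintro - v - - - ⟨F, rfl⟩; exact (laminate_coercive_gt_one F hq).2⟩

/-- **NO-GO K37 — L-λ(q) RESTRICTED TO THE LAMINATE CLASS HOLDS for every real `q > 1`** (both cores): no
`x₂`-laminate `u_F` refutes `TopEigHeatCoercivePos q` for any `q > 1` (contrast K32: at `q = 1` a laminate kills it).
A refuting family for some real `q > 1`, if any, is genuinely non-laminate. [ours] -/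
theorem heatCoercivePos_laminate_gt_one {q : ℝ} (hq : 1 < q) :
    (∃ c : ℝ, 0 < c ∧ HeatCoerciveOn (d := Fin 3) IsX2Laminate (torusTopEigMoment q) c) ∧
      ∃ c : ℝ, 0 < c ∧ HeatCoerciveOn (d := Fin 3) IsX2Laminate (torusNegBotEigMoment q) c :=
  have hc : 0 < 4 * π ^ 2 * (q - 1) / q := div_pos (mul_pos (by positivity) (by linarith)) (by linarith)
  ⟨⟨_, hc, (heatCoerciveOn_laminate_gt_one hq).1⟩, ⟨_, hc, (heatCoerciveOn_laminate_gt_one hq).2⟩⟩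

/-- **A kill witness for L-λ(q), any real `q > 1`, at any rate `c ≤ 4π²(q−1)/q` is NOT an `x₂`-laminate** (top
core; the `−λ₃` core alike). [ours] -/
theorem kill_not_laminate_gt_one {q : ℝ} (hq : 1 < q) {c : ℝ} (hc : c ≤ 4 * π ^ 2 * (q - 1) / q)
    {v : UnitAddTorus (Fin 3) → EuclideanSpace ℝ (Fin 3)}
    (hv : heatDissipation (torusTopEigMoment q) v < c * torusTopEigMoment q v ∨
      heatDissipation (torusNegBotEigMoment q) v < c * torusNegBotEigMoment q v) : ¬ IsX2Laminate v := by
  rintro ⟨F, rfl⟩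
  obtain ⟨h1, h2⟩ := laminate_coercive_gt_one F hq
  rcases hv with hv | hv
  · exact not_lt.2 ((mul_le_mul_of_nonneg_right hc (torusTopEigMoment_nonneg q (lamU F))).trans h1) hv
  · exact not_lt.2 ((mul_le_mul_of_nonneg_right hc (torusNegBotEigMoment_nonneg q (lamU F))).trans h2) hv

end TopEigLaminate

end Summit.NavierStokesRegularity.FunctionalMining

end
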